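import Literature.Computability.Complexity.CircuitComposition
import Summits.PneNP.PneNP.Theorems.CliqueExtLowerBound.Negative.PermConsequences
import Summits.PneNP.PneNP.Theorems.ConvexRankGatesCaptureDefs
import Summits.PneNP.PneNP.Theorems.ConvexRankGatesCaptureAbelianCosetFredholm
import HarnessLib

/-!
# Route ConvexRankGates, crux `Capture` (stmt-PneNP-2659), line `csp-spine-meet-to-join`:
# Stub 3a `stub_cosetMeetToJoinAbelian` — abelian coset meet-to-join

PROGRESS LOG (worker S3a, 2026-08-16):
* file A `ConvexRankGatesCaptureAbelianCosetFredholm.lean` (pure group theory: the abelian coset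
  Fredholm alternative `abelianCosetFredholm`, the small faithful model `abEmb`, transport
  `ab_mem_closure_image_iff`) — sorry-free, lean check rc 0;
* this file B: circuits — OR-fold over `permBasis`, one PERM gate per nontrivial character of
  `ZMod |G|` via `abelianProgram_isPermGate`, assembly of the stub.

**Statement** (`stub_cosetMeetToJoinAbelian`, registered): there is `c` (`c = 3`) such that every
abelian COSET gate with size parameter `s` (`IsAbelianCosetGate s g`: a finite abelian group `G`,
`|G| ≤ s`, variables `Fin nv`, `nv ≤ s`, input `j` selecting the constraint
`(c j)⁻¹ * h ∘ scope j ∈ H j`, `H j ≤ G^{r j}`; the gate fires iff the selected constraints have no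
common solution) is computed by a circuit over
`permBasis ((s+2)^c) = {∧₂, ∨₂, 1, 0} ∪ PERM_{(s+2)^c}` with at most `(s+2)^c` gates.

**Proof.** Write `A = Additive G`, `e = |A|`.  By the abelian coset Fredholm alternative
(`abelianCosetFredholm`, file A) the gate fires on the selection `v` iff for some character
`ω ≠ 0` of `ZMod e` the pair `(0, ω)` lies in the subgroup of `Â^{nv} × (ZMod e)̂` generated by the
selected generators `abGen j χ` (`v j = true`, `χ ∈ (H j)^⊥`).  Transporting along the injective
homomorphism `abEmb : Â^{nv} × (ZMod e)̂ →+ (Option (Fin nv) → Â × (ZMod e)̂)` (file A), each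
condition "`(0, ω) ∈ ⟨selected generators⟩`" is ONE abelian group program over the finite abelian
group `Â × (ZMod e)̂` (`e²` elements) with `nv + 1` coordinates, rows = generators wired to their
constraint `j`, hence ONE PERM gate on `e² (nv + 1) ≤ (s+2)^3` points
(`abelianProgram_isPermGate`).  The gate function is the OR of these `≤ e - 1 ≤ s` PERM gates
(`ab_cktSize_exists`: `2 (e - 1) + 1 ≤ (s+2)^3` gates of `permBasis`, the empty OR being the
constant `0`).

References: the line card `Cruxes/Capture/Lines/csp-spine-meet-to-join.md` (Stub 3a); folklore
(Pontryagin duality for finite abelian groups; Furst–Hopcroft–Luks 1980 for PERM gates).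
-/

namespace Summit.PneNP.PneNP.Cruxes.Capture.CspSpineMeetToJoin

set_option linter.dupNamespace false -- `Summit.PneNP.PneNP.…`: summit = sub-problem (D-0017)

open Literature.Computability.Complexity AddChar
open Summit.PneNP.PneNP.Theorems.CliqueExtLowerBound.Negative (abelianProgram_isPermGate)

/-! ## An OR of single gates over a basis containing `∨₂` and `0` -/

section OrFold

variable {ι : Type*} {B : Set GateFn}

/-- **OR-fold**: if each `fz z` (`z ∈ F`) is computed by one gate of `B` wired to the inputs and
`B ∋ ∨₂, 0`, then `x ↦ [∃ z ∈ F, fz z x]` has a `B`-circuit with `2 |F| + 1` gates (a chain of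
`∨₂`s ending in the constant `0`). [folklore] -/
theorem ab_cktSize_exists (hor : GateFn.or 2 ∈ B) (hfalse : GateFn.const false ∈ B) {Z : Type*}
    [DecidableEq Z] (fz : Z → (ι → Bool) → Bool) (F : Finset Z)
    (hfz : ∀ z ∈ F, CktSize B (fun x (_ : Unit) => fz z x) 1) :
    CktSize B (fun x (_ : Unit) => decide (∃ z ∈ F, fz z x = true)) (2 * F.card + 1) := by
  induction F using Finset.induction_on with
  | empty =>
    refine ((CktSize.gate (GateFn.const false) hfalse (Fin.elim0 : Fin 0 → ι)).congr
      fun x _ => ?_).of_le (by simp)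
    simp [GateFn.const]
  | insert a F ha ih =>
    have h1 := (hfz a (Finset.mem_insert_self a F)).pair
      (ih fun z hz => hfz z (Finset.mem_insert_of_mem hz))
    have h2 : CktSize B
        (fun (y : Unit ⊕ Unit → Bool) (_ : Unit) => (y (Sum.inl ()) || y (Sum.inr ()))) 1 :=
      (CktSize.gate (GateFn.or 2) hor ![Sum.inl (), Sum.inr ()]).congr fun y _ => by
        simp only [GateFn.or, Fin.exists_fin_two, Matrix.cons_val_zero, Matrix.cons_val_one,
          Bool.decide_or, Bool.decide_eq_true]
    refine ((h1.comp h2).congr fun x _ => ?_).of_le ?_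
    · simp only [Sum.elim_inl, Sum.elim_inr, Finset.exists_mem_insert, Bool.decide_or,
        Bool.decide_eq_true]
    · rw [Finset.card_insert_of_notMem ha]
      omega

end OrFold

/-! ## The abelian coset gate as an OR of PERM gates -/

section Core

variable {A : Type} [AddCommGroup A] [Fintype A] {nv m : ℕ} {r : Fin m → ℕ}

/-- **Core construction.** For coset-CSP data over a finite abelian group `A` (additive) and a
Boolean function `f` of the selection that is `true` iff the selected constraints are jointly
unsatisfiable, `f` has a circuit over `permBasis S` with `≤ 2 |A| + 1` gates as soon as
`|A|² (nv + 1) ≤ S`: the OR over the nontrivial characters `ω` of `ZMod |A|` of the PERM gates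
"`(0, ω) ∈ ⟨selected generators⟩`" (`abelianCosetFredholm` + `abEmb` + `abelianProgram_isPermGate`).
[folklore] -/
theorem ab_cktSize_unsat (scope : (j : Fin m) → Fin (r j) → Fin nv)
    (H : (j : Fin m) → AddSubgroup (Fin (r j) → A)) (c : (j : Fin m) → Fin (r j) → A)
    (f : (Fin m → Bool) → Bool)
    (hf : ∀ v, f v = true ↔
      ¬ ∃ h : Fin nv → A, ∀ j, v j = true → -c j + (fun i => h (scope j i)) ∈ H j)
    {S : ℕ} (hS : Fintype.card A ^ 2 * (nv + 1) ≤ S) :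
    CktSize (permBasis S) (fun v (_ : Unit) => f v) (2 * Fintype.card A + 1) := by
  classical
  -- indexing of the generators: pairs `⟨j, χ⟩`, `χ ∈ (H j)^⊥`
  set Idx := (Σ j : Fin m, abAnnih H j)
  set N : ℕ := Fintype.card Idx
  set eq : Idx ≃ Fin N := Fintype.equivFin Idx
  set wire : Fin N → Fin m := fun i => (eq.symm i).1 with hwire
  -- the small faithful model: rows and targets in `Option (Fin nv) → Â × (ZMod |A|)̂`
  set ρ : Fin N → Option (Fin nv) → AddChar A ℂ × AddChar (ZMod (Fintype.card A)) ℂ :=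
    fun i => abEmb nv (abGen scope c (eq.symm i).1 (eq.symm i).2) with hρ
  set fω : AddChar (ZMod (Fintype.card A)) ℂ → (Fin N → Bool) → Bool := fun ω u =>
    decide (Multiplicative.ofAdd (abEmb nv (0, ω)) ∈
      Subgroup.closure ((fun i => Multiplicative.ofAdd (ρ i)) '' {i | u i = true})) with hfω
  -- each `fω ω` is ONE PERM gate on `|A|² (nv + 1) ≤ S` points
  have hperm : ∀ ω, IsPermGate S ⟨N, fω ω⟩ := fun ω => by
    refine (abelianProgram_isPermGate ρ (abEmb nv (0, ω)) (fω ω) fun u => ?_).mono ?_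
    · rw [hfω]
      exact decide_eq_true_iff
    · simp only [Fintype.card_prod, Fintype.card_option, Fintype.card_fin, AddChar.card_eq,
        ZMod.card]
      simpa [pow_two] using hS
  have hgate : ∀ ω, CktSize (permBasis S) (fun (x : Fin m → Bool) (_ : Unit) =>
      fω ω fun i => x (wire i)) 1 := fun ω =>
    CktSize.gate (B := permBasis S) ⟨N, fω ω⟩ (Or.inr (hperm ω)) wire
  -- semantics of the PERM gate `ω`: `(0, ω) ∈ ⟨selected generators⟩`
  have hsem : ∀ ω (x : Fin m → Bool), fω ω (fun i => x (wire i)) = true ↔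
      ((0 : AddChar (Fin nv → A) ℂ), ω) ∈ AddSubgroup.closure (abGens scope H c x) := by
    intro ω x
    rw [hfω]
    simp only [decide_eq_true_eq]
    have himg : (fun i => Multiplicative.ofAdd (ρ i)) '' {i | x (wire i) = true} =
        (fun q => Multiplicative.ofAdd (abEmb nv q)) '' abGens scope H c x := by
      ext g
      simp only [Set.mem_image, Set.mem_setOf_eq, abGens, hρ, hwire]
      constructor
      · rintro ⟨i, hi, rfl⟩
        exact ⟨_, ⟨eq.symm i, hi, rfl⟩, rfl⟩
      · rintro ⟨q, ⟨p, hp, rfl⟩, rfl⟩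
        refine ⟨eq p, ?_, ?_⟩
        · simpa using hp
        · rw [Equiv.symm_apply_apply]
    rw [himg]
    exact ab_mem_closure_image_iff (fun q => Multiplicative.ofAdd (abEmb nv q))
      (by simp) (fun a b => by simp [ofAdd_add]) (Multiplicative.ofAdd.injective.comp
        (abEmb_injective nv)) _ _
  -- the OR over the nontrivial characters of `ZMod |A|`
  have hor : GateFn.or 2 ∈ permBasis S := Or.inl (by simp [monConst])
  have hfalse : GateFn.const false ∈ permBasis S := Or.inl (by simp [monConst])
  have hF := ab_cktSize_exists hor hfalse (fun ω (x : Fin m → Bool) => fω ω fun i => x (wire i))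
    (Finset.univ.erase 0) fun ω _ => hgate ω
  refine (hF.congr fun x _ => ?_).of_le ?_
  · rw [Bool.eq_iff_iff, decide_eq_true_iff, hf x, abelianCosetFredholm scope H c x]
    constructor
    · rintro ⟨ω, hω, h⟩
      exact ⟨ω, (Finset.mem_erase.1 hω).1, (hsem ω x).1 h⟩
    · rintro ⟨ω, hω, h⟩
      exact ⟨ω, Finset.mem_erase.2 ⟨hω, Finset.mem_univ _⟩, (hsem ω x).2 h⟩
  · have : (Finset.univ.erase (0 : AddChar (ZMod (Fintype.card A)) ℂ)).card ≤ Fintype.card A :=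
      (Finset.card_le_univ _).trans (by rw [AddChar.card_eq, ZMod.card])
    omega

end Core

/-! ## The stub -/

/-- **Stub 3a — abelian coset meet-to-join** (`CosetMeetToJoinAbelian` of the line
`csp-spine-meet-to-join`, crux `ConvexRankGates.Capture`): every abelian COSET gate with size
parameter `s` is computed by a circuit over `{∧₂, ∨₂, 1, 0} ∪ PERM_{(s+2)^3}` with `≤ (s+2)^3`
gates — an OR of `≤ s` PERM gates of width `|G|² (nv + 1)`, by Pontryagin duality
(`abelianCosetFredholm`: emptiness of an intersection of selected cosets, a MEET, is membership of
some `(0, ω)`, `ω ≠ 0`, in the subgroup generated by the selected annihilator graphs, a JOIN).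
[folklore] -/
theorem stub_cosetMeetToJoinAbelian : ∃ c : ℕ, ∀ (s : ℕ) (g : GateFn), IsAbelianCosetGate s g →
    ∃ C : Circuit (Fin g.1), C.IsOver (permBasis ((s + 2) ^ c)) ∧ C.size ≤ (s + 2) ^ c ∧
      C.Computes g.2 := by
  refine ⟨3, fun s g hg => ?_⟩
  obtain ⟨-, G, iG, iF, nv, hcomm, hG, hnv, r, scope, H, c, -, hiff⟩ := hg
  letI : CommGroup G := CommGroup.mk hcomm
  -- size bookkeeping: `|G|² (nv + 1) ≤ (s+2)^3` and `2 |G| + 1 ≤ (s+2)^3`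
  have h2 : (2 : ℕ) ^ 2 ≤ (s + 2) ^ 2 := Nat.pow_le_pow_left (by omega) 2
  have hS : Fintype.card (Additive G) ^ 2 * (nv + 1) ≤ (s + 2) ^ 3 := by
    rw [Fintype.card_additive, pow_succ]
    exact Nat.mul_le_mul (Nat.pow_le_pow_left (by omega) 2) (by omega)
  have hsize : 2 * Fintype.card (Additive G) + 1 ≤ (s + 2) ^ 3 := by
    rw [Fintype.card_additive, pow_succ]
    calc 2 * Fintype.card G + 1 ≤ 2 ^ 2 * (s + 2) := by omega
      _ ≤ (s + 2) ^ 2 * (s + 2) := Nat.mul_le_mul_right _ h2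
  -- the core construction over `A = Additive G`
  have hcore := ab_cktSize_unsat (A := Additive G) scope (fun j => (H j).toAddSubgroup)
    (fun j i => Additive.ofMul (c j i)) g.2 (fun v => hiff v) hS
  obtain ⟨C, hC, hCs, hCe⟩ := (hcore.of_le hsize).toCircuit
  exact ⟨C, hC, hCs, fun x => hCe x⟩

end Summit.PneNP.PneNP.Cruxes.Capture.CspSpineMeetToJoin
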